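import Summits.AnomalousDissipation.AnomalousDissipation.Theorems.ImpulseGridGridInjectionIdentity

/-!
# Line `Sketch` for crux `GridSignsLaw` (item stmt-AnomalousDissipation-14349, route ImpulseGrid) —
stub `stub_gridInjectionIdentity`

The registered stub `stub_gridInjectionIdentity` of the lead skeleton `Lines/Sketch.lean` is the
route's exact GRID INJECTION IDENTITY `ImpulseGrid.GridInjectionIdentity` (support item
stmt-AnomalousDissipation-1774), both conjuncts: for the slab⊗transverse force `f = Φ • G`
(`G` smooth, `G₀ ≡ 0`, `x₀`-invariant, divergence free; `Ψ` smooth, `x⊥`-invariant,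
`∂₀Ψ = Φ − 1`), any constant `c`, `w := u − c e₀`, a global Leray–Hopf solution `u` with a
sup-in-time energy bound, and any generalized limit `Λ`,

1. `c·Λ⟨(Φ•G,u)⟩ = c·Λ⟨(G,u)⟩ − Λ⟨∫⟪w,(w·∇)(Ψ•G)⟫⟩ − ν·Λ⟨(u,Δ(Ψ•G))⟩ − ∫ΦΨ‖G‖²`;
2. `Λ⟨∫⟪w,(w·∇)G⟫⟩ = −∫Φ‖G‖² − ν·Λ⟨(u,ΔG)⟩`.

The identity is ALREADY IN THE TREE as
`Summit.AnomalousDissipation.AnomalousDissipation.Theorems.impulseGrid_gridInjectionIdentity`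
(file `Theorems/ImpulseGridGridInjectionIdentity.lean`, which settles item 1774: the mean momentum
balance `meanMomentumBalance_proof` tested with `Ψ • G` and with `G`, the pointwise algebra
`⟪u,(u·∇)V⟫ = ⟪w,(w·∇)V⟫ + c⟪u,∂₀V⟫` for `V₀ ≡ 0`, `∂₀(Ψ•G) = (Φ−1)•G`, `∂₀G = 0`, and linearity of
`Λ ∘ timeMean` on interval-integrable pieces; Foias–Manley–Rosa–Temam 2001, Ch. IV §3.1;
Doering–Foias 2002, §2). This file only exports it under the registered stub name
`stub_gridInjectionIdentity` that the line's composition `GridSignsLaw_of` consumes (the stub was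
registered by the skeleton check of stmt-AnomalousDissipation-14349, which matches landed stubs by
name and signature). No mathematics is duplicated and nothing new is defined.
-/

-- `Summit.<Summit>.<Problem>` is the tree's mandated summit-side namespace (CONVENTIONS §2); for this
-- single-conjunct summit the two coincide, so the duplicate is deliberate.
set_option linter.dupNamespace false

namespace Summit.AnomalousDissipation.AnomalousDissipation.Theorems

/-- **Stub `stub_gridInjectionIdentity` of line `Sketch` (crux `GridSignsLaw`,
stmt-AnomalousDissipation-14349)**: the route's grid injection identity
`ImpulseGrid.GridInjectionIdentity` — (1) the sawtooth identity
`c·Λ⟨(Φ•G,u)⟩ = c·Λ⟨(G,u)⟩ − Λ⟨∫⟪w,(w·∇)(Ψ•G)⟫⟩ − ν·Λ⟨(u,Δ(Ψ•G))⟩ − ∫ΦΨ‖G‖²` and (2) the pinned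
transverse stress `Λ⟨∫⟪w,(w·∇)G⟫⟩ = −∫Φ‖G‖² − ν·Λ⟨(u,ΔG)⟩`, `w = u − c e₀` — by the tree's
`impulseGrid_gridInjectionIdentity` (mean momentum balance tested with `Ψ•G` and `G`;
Foias–Manley–Rosa–Temam 2001, Ch. IV §3.1). [folklore] -/
theorem stub_gridInjectionIdentity :
    Summit.AnomalousDissipation.AnomalousDissipation.Theses.ImpulseGrid.GridInjectionIdentity :=
  impulseGrid_gridInjectionIdentity

end Summit.AnomalousDissipation.AnomalousDissipation.Theorems
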